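import Mathlib.Analysis.Fourier.AddCircle
import Mathlib.Analysis.InnerProductSpace.PiL2
import Mathlib.MeasureTheory.Integral.IntervalIntegral.FundThmCalculus
import HarnessLib

/-!
# The resolvent (pseudospectral) energy inequality on a time interval

Let `E` be a finite-dimensional complex inner-product space, `H : E →L[ℂ] E`, and suppose the
**pseudospectral (resolvent) lower bound** `Ψ‖v‖ ≤ ‖Hv − iμv‖` holds for every real `μ` and every
`v` (i.e. `Ψ ≤ Ψ(H) := inf_{μ ∈ ℝ} inf_{‖v‖=1} ‖(H − iμ)v‖`, the pseudospectral abscissa of Wei /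
Gallagher–Gérard-Varet–Nier). Then for every `C¹` curve `F : [a,b] → E` VANISHING AT BOTH ENDPOINTS,

`Ψ² ∫ₐᵇ ‖F(s)‖² ds ≤ ∫ₐᵇ ‖F′(s) + H F(s)‖² ds`.

This is the Plancherel step in D. Wei's proof of his Gearhart–Prüss type theorem (Wei, *Diffusion and
mixing in fluid flow via the resolvent estimate*, Sci. China Math. 64 (2021), proof of Thm 1.3, §2:
"`f̂₂(λ) = (iλ + H) f̂₁(λ)` … By the definition of `Ψ`, `‖f̂₂(λ)‖ ≥ Ψ‖f̂₁(λ)‖`. We use Plancherel's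
Theorem to conclude `‖f₂‖_{L²([0,l],X)} ≥ Ψ‖f₁‖_{L²([0,l],X)}`"), here carried out with FOURIER SERIES on
`[a,b]` instead of the Fourier transform on `ℝ` (legitimate because `F(a) = F(b) = 0` kills the boundary
term of the integration by parts, so that `𝓕ₙ(F′) = (2πin/(b−a)) 𝓕ₙ(F)` for EVERY `n ∈ ℤ`), and
componentwise in an orthonormal basis so that only Mathlib's scalar Parseval identity on an interval
(`hasSum_sq_fourierCoeffOn`) and scalar integration by parts (`fourierCoeffOn_of_hasDerivAt_Ioo`) are
used. The Gearhart–Prüss theorem itself is in `Literature.Analysis.OperatorTheory.GearhartPrussAccretive`.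

## Contents
* (private) `fourierCoeffOn_add'`, `fourierCoeffOn_const_mul'`, `fourierCoeffOn_finset_sum'` — linearity
  of the interval Fourier coefficients for continuous integrands (plumbing);
* `fourierCoeffOn_deriv_of_eq_zero` — `𝓕ₙ(φ′) = (2πin/(b−a))·𝓕ₙ(φ)` for all `n` when `φ(a) = φ(b) = 0`;
* `sq_mul_integral_norm_sq_le_of_resolvent_bound` — the displayed inequality.

Everything is proved; no definitions, no named facts.
-/

noncomputable section

namespace Literature.Analysis.OperatorTheory

open scoped InnerProductSpace Real
open _root_.Complex MeasureTheory intervalIntegral Set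

/-! ## Scalar plumbing: interval Fourier coefficients of continuous functions -/

section Scalar

variable {a b : ℝ}

/-- The character `x ↦ e^{2πi n x/T}` pulled back to `ℝ` is continuous. [folklore] -/
private theorem continuous_fourier_coe (T : ℝ) (n : ℤ) :
    Continuous fun x : ℝ => fourier n (x : AddCircle T) := by
  have : (fun x : ℝ => fourier n (x : AddCircle T)) =
      fun x : ℝ => Complex.exp (2 * π * I * n * x / T) := by
    funext x; exact fourier_coe_apply
  rw [this]
  fun_prop

/-- Continuity of the Fourier integrand `x ↦ e^{-2πinx/(b-a)} φ(x)` on `[a,b]`. [folklore] -/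
private theorem continuousOn_fourier_mul (hab : a < b) {φ : ℝ → ℂ} (hφ : ContinuousOn φ (Icc a b))
    (n : ℤ) : ContinuousOn (fun x : ℝ => fourier (-n) (x : AddCircle (b - a)) • φ x) (uIcc a b) := by
  rw [uIcc_of_le hab.le]
  exact ((continuous_fourier_coe (b - a) (-n)).continuousOn).smul hφ

/-- Additivity of interval Fourier coefficients (continuous integrands). [folklore] -/
private theorem fourierCoeffOn_add' (hab : a < b) {φ ψ : ℝ → ℂ} (hφ : ContinuousOn φ (Icc a b))
    (hψ : ContinuousOn ψ (Icc a b)) (n : ℤ) :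
    fourierCoeffOn hab (fun x => φ x + ψ x) n = fourierCoeffOn hab φ n + fourierCoeffOn hab ψ n := by
  rw [fourierCoeffOn_eq_integral, fourierCoeffOn_eq_integral, fourierCoeffOn_eq_integral, ← smul_add,
    ← intervalIntegral.integral_add ((continuousOn_fourier_mul hab hφ n).intervalIntegrable)
      ((continuousOn_fourier_mul hab hψ n).intervalIntegrable)]
  congr 1
  refine intervalIntegral.integral_congr fun x _ => ?_
  simp only [smul_eq_mul, mul_add]

/-- Homogeneity of interval Fourier coefficients. [folklore] -/
private theorem fourierCoeffOn_const_mul' (hab : a < b) (φ : ℝ → ℂ) (c : ℂ) (n : ℤ) :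
    fourierCoeffOn hab (fun x => c * φ x) n = c * fourierCoeffOn hab φ n := by
  rw [fourierCoeffOn_eq_integral, fourierCoeffOn_eq_integral]
  have : (fun x : ℝ => fourier (-n) (x : AddCircle (b - a)) • (c * φ x)) =
      fun x : ℝ => c • (fourier (-n) (x : AddCircle (b - a)) • φ x) := by
    funext x; simp only [smul_eq_mul]; ring
  rw [this, intervalIntegral.integral_smul, smul_comm, smul_eq_mul]

/-- Interval Fourier coefficients of a finite sum of continuous functions. [folklore] -/
private theorem fourierCoeffOn_finset_sum' (hab : a < b) {ι : Type*} (s : Finset ι) {φ : ι → ℝ → ℂ}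
    (hφ : ∀ i ∈ s, ContinuousOn (φ i) (Icc a b)) (n : ℤ) :
    fourierCoeffOn hab (fun x => ∑ i ∈ s, φ i x) n = ∑ i ∈ s, fourierCoeffOn hab (φ i) n := by
  classical
  induction s using Finset.induction_on with
  | empty =>
    simp only [Finset.sum_empty]
    rw [fourierCoeffOn_eq_integral]
    simp
  | @insert j s hj ih =>
    have hs : ∀ i ∈ s, ContinuousOn (φ i) (Icc a b) := fun i hi => hφ i (Finset.mem_insert_of_mem hi)
    have hsum : ContinuousOn (fun x => ∑ i ∈ s, φ i x) (Icc a b) := continuousOn_finsetSum s hs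
    simp only [Finset.sum_insert hj]
    rw [fourierCoeffOn_add' hab (hφ j (Finset.mem_insert_self j s)) hsum, ih hs]

/-- **Fourier coefficients of a derivative, no boundary term.** If `φ` is continuous on `[a,b]`,
differentiable on `(a,b)` with continuous derivative `φ′`, and `φ(a) = φ(b) = 0`, then for EVERY
`n ∈ ℤ` (including `n = 0`): `𝓕ₙ(φ′) = (2πin/(b−a)) 𝓕ₙ(φ)` on `[a,b]`. [cite: Wei2019, §2, proof of Thm 1.3 ("∂ₜf₁ + Hf₁ = f₂ … f̂₂(λ) = (iλ + H)f̂₁(λ)")] -/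
theorem fourierCoeffOn_deriv_of_eq_zero (hab : a < b) {φ φ' : ℝ → ℂ} (hφ : ContinuousOn φ (Icc a b))
    (hφ' : ContinuousOn φ' (Icc a b)) (hderiv : ∀ x ∈ Ioo a b, HasDerivAt φ (φ' x) x)
    (ha : φ a = 0) (hb : φ b = 0) (n : ℤ) :
    fourierCoeffOn hab φ' n = (2 * π * I * n / (b - a)) * fourierCoeffOn hab φ n := by
  have hba : (b : ℂ) - a ≠ 0 := by
    rw [← Complex.ofReal_sub]; exact_mod_cast (sub_pos.mpr hab).ne'
  have hint : IntervalIntegrable φ' volume a b :=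
    (hφ'.mono (by rw [uIcc_of_le hab.le])).intervalIntegrable
  rcases eq_or_ne n 0 with hn | hn
  · -- `n = 0`: `𝓕₀(φ′) = (b-a)⁻¹ ∫ φ′ = (b-a)⁻¹ (φ b - φ a) = 0`.
    subst hn
    rw [fourierCoeffOn_eq_integral]
    have h1 : (fun x : ℝ => fourier (-(0 : ℤ)) (x : AddCircle (b - a)) • φ' x) = φ' := by
      funext x; simp
    rw [h1, intervalIntegral.integral_eq_sub_of_hasDerivAt_of_le hab.le hφ hderiv hint, ha, hb]
    simp
  · have h := fourierCoeffOn_of_hasDerivAt_Ioo hab hn (by rw [uIcc_of_le hab.le]; exact hφ)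
      (by rw [min_eq_left hab.le, max_eq_right hab.le]; exact hderiv) hint
    rw [ha, hb, sub_zero, mul_zero, zero_sub] at h
    have hI : (-2 * (π : ℂ) * I * n) ≠ 0 := by
      have hπ : (π : ℂ) ≠ 0 := by exact_mod_cast Real.pi_ne_zero
      have hn' : (n : ℂ) ≠ 0 := by exact_mod_cast hn
      simp [hπ, hn', Complex.I_ne_zero]
    rw [h]
    field_simp

end Scalar

/-! ## The vector inequality -/

section Vector

variable {E : Type*} [NormedAddCommGroup E] [InnerProductSpace ℂ E] [FiniteDimensional ℂ E]

omit [FiniteDimensional ℂ E] in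
/-- Coordinates in an orthonormal basis recover the norm: `‖v‖² = ∑ᵢ ‖⟪bᵢ, v⟫‖²`. [folklore] -/
private theorem norm_sq_eq_sum_norm_sq_inner {ι : Type*} [Fintype ι] (b : OrthonormalBasis ι ℂ E)
    (v : E) : ‖v‖ ^ 2 = ∑ i, ‖⟪b i, v⟫_ℂ‖ ^ 2 := by
  rw [← b.repr.norm_map v, EuclideanSpace.norm_sq_eq]
  simp [b.repr_apply_apply]

omit [FiniteDimensional ℂ E] in
/-- The vector `b.repr.symm c` with prescribed coordinates `c` in the orthonormal basis `b` has
`i`-th coordinate `c i`. [folklore] -/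
private theorem inner_ofCoords {ι : Type*} [Fintype ι] (b : OrthonormalBasis ι ℂ E) (c : ι → ℂ)
    (i : ι) : ⟪b i, b.repr.symm (WithLp.toLp 2 c)⟫_ℂ = c i := by
  rw [← b.repr_apply_apply]
  simp

omit [FiniteDimensional ℂ E] in
/-- `‖b.repr.symm c‖² = ∑ᵢ ‖cᵢ‖²`. [folklore] -/
private theorem norm_sq_ofCoords {ι : Type*} [Fintype ι] (b : OrthonormalBasis ι ℂ E) (c : ι → ℂ) :
    ‖b.repr.symm (WithLp.toLp 2 c)‖ ^ 2 = ∑ i, ‖c i‖ ^ 2 := by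
  rw [norm_sq_eq_sum_norm_sq_inner b]
  simp [inner_ofCoords]

omit [FiniteDimensional ℂ E] in
/-- Two vectors with the same coordinates are equal. [folklore] -/
private theorem ext_inner_orthonormalBasis_coords {ι : Type*} [Fintype ι] (b : OrthonormalBasis ι ℂ E) {v w : E}
    (h : ∀ i, ⟪b i, v⟫_ℂ = ⟪b i, w⟫_ℂ) : v = w := by
  apply b.repr.injective
  ext i
  simp [b.repr_apply_apply, h i]

/-- **The resolvent energy inequality** (Plancherel step of Wei's Gearhart–Prüss theorem, finite
dimension). Let `H : E →L[ℂ] E` on a finite-dimensional complex inner-product space satisfy the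
pseudospectral lower bound `Ψ‖v‖ ≤ ‖Hv − iμ v‖` for all `μ ∈ ℝ`, `v ∈ E` (`0 ≤ Ψ`). If `F` is
continuous on `[a,b]` (`a < b`) with a continuous derivative `F′` on `(a,b)` (continuous on `[a,b]`) and
`F(a) = F(b) = 0`, then `Ψ² ∫ₐᵇ ‖F‖² ≤ ∫ₐᵇ ‖F′ + HF‖²`. (Wei: `f₁ = χ e^{-sH}f`, `f₂ = ∂ₛf₁ + Hf₁`,
"`‖f₂‖_{L²([0,l],X)} ≥ Ψ‖f₁‖_{L²([0,l],X)}`".) [cite: Wei2019, §2, proof of Thm 1.3] -/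
theorem sq_mul_integral_norm_sq_le_of_resolvent_bound (H : E →L[ℂ] E) {Ψ : ℝ} (hΨ0 : 0 ≤ Ψ)
    (hΨ : ∀ (μ : ℝ) (v : E), Ψ * ‖v‖ ≤ ‖H v - ((μ : ℂ) * I) • v‖) {a b : ℝ} (hab : a < b)
    {F F' : ℝ → E} (hF : ContinuousOn F (Icc a b)) (hF' : ContinuousOn F' (Icc a b))
    (hderiv : ∀ x ∈ Ioo a b, HasDerivAt F (F' x) x) (ha : F a = 0) (hb : F b = 0) :
    Ψ ^ 2 * ∫ x in a..b, ‖F x‖ ^ 2 ≤ ∫ x in a..b, ‖F' x + H (F x)‖ ^ 2 := by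
  set bs := stdOrthonormalBasis ℂ E with hbs
  -- coordinates of `F`, `F'` and `G := F' + HF`
  set φ : Fin (Module.finrank ℂ E) → ℝ → ℂ := fun i x => ⟪bs i, F x⟫_ℂ with hφ
  set φ' : Fin (Module.finrank ℂ E) → ℝ → ℂ := fun i x => ⟪bs i, F' x⟫_ℂ with hφ'
  set G : ℝ → E := fun x => F' x + H (F x) with hG
  set ψ : Fin (Module.finrank ℂ E) → ℝ → ℂ := fun i x => ⟪bs i, G x⟫_ℂ with hψ
  have hGc : ContinuousOn G (Icc a b) := hF'.add (H.continuous.comp_continuousOn hF)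
  have hφc : ∀ i, ContinuousOn (φ i) (Icc a b) := fun i =>
    (innerSL ℂ (bs i)).continuous.comp_continuousOn hF
  have hφ'c : ∀ i, ContinuousOn (φ' i) (Icc a b) := fun i =>
    (innerSL ℂ (bs i)).continuous.comp_continuousOn hF'
  have hψc : ∀ i, ContinuousOn (ψ i) (Icc a b) := fun i =>
    (innerSL ℂ (bs i)).continuous.comp_continuousOn hGc
  have hφd : ∀ i, ∀ x ∈ Ioo a b, HasDerivAt (φ i) (φ' i x) x := by
    intro i x hx
    have h := (hasDerivAt_const x (bs i)).inner ℂ (hderiv x hx)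
    simpa using h
  -- the matrix of `H` in the basis and the expansion of `⟪bᵢ, H F⟫`
  have hHF : ∀ i x, ⟪bs i, H (F x)⟫_ℂ = ∑ j, ⟪bs i, H (bs j)⟫_ℂ * φ j x := by
    intro i x
    conv_lhs => rw [← bs.sum_repr' (F x)]
    simp only [map_sum, map_smul, inner_sum, inner_smul_right, hφ]
    exact Finset.sum_congr rfl fun j _ => mul_comm _ _
  -- Step 1–2: the coefficient relation `𝓕ₙ(ψᵢ) = (2πin/(b-a)) 𝓕ₙ(φᵢ) + Σⱼ ⟪bᵢ,Hbⱼ⟫ 𝓕ₙ(φⱼ)`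
  have hcoef : ∀ i n, fourierCoeffOn hab (ψ i) n =
      (2 * π * I * n / (b - a)) * fourierCoeffOn hab (φ i) n +
        ∑ j, ⟪bs i, H (bs j)⟫_ℂ * fourierCoeffOn hab (φ j) n := by
    intro i n
    have h1 : ψ i = fun x => φ' i x + ∑ j, ⟪bs i, H (bs j)⟫_ℂ * φ j x := by
      funext x
      simp only [hψ, hG, inner_add_right, hφ']
      rw [hHF]
    have hcj : ∀ j ∈ (Finset.univ : Finset (Fin (Module.finrank ℂ E))),
        ContinuousOn (fun x => ⟪bs i, H (bs j)⟫_ℂ * φ j x) (Icc a b) :=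
      fun j _ => continuousOn_const.mul (hφc j)
    have hsumc : ContinuousOn (fun x => ∑ j, ⟪bs i, H (bs j)⟫_ℂ * φ j x) (Icc a b) :=
      continuousOn_finsetSum _ hcj
    rw [h1, fourierCoeffOn_add' hab (hφ'c i) hsumc,
      fourierCoeffOn_deriv_of_eq_zero hab (hφc i) (hφ'c i) (hφd i) (by simp [hφ, ha]) (by simp [hφ, hb]),
      fourierCoeffOn_finset_sum' hab (φ := fun j x => ⟪bs i, H (bs j)⟫_ℂ * φ j x) _ hcj]
    congr 1
    exact Finset.sum_congr rfl fun j _ => fourierCoeffOn_const_mul' hab _ _ _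
  -- Step 3: the vectors `Xₙ`, `Yₙ` and the identity `Yₙ = H Xₙ − iμₙ Xₙ`, `μₙ = -2πn/(b-a)`
  set X : ℤ → E := fun n => bs.repr.symm (WithLp.toLp 2 fun j => fourierCoeffOn hab (φ j) n) with hX
  set Y : ℤ → E := fun n => bs.repr.symm (WithLp.toLp 2 fun j => fourierCoeffOn hab (ψ j) n) with hY
  have hXY : ∀ n : ℤ, Y n = H (X n) - (((-(2 * π * n / (b - a)) : ℝ) : ℂ) * I) • X n := by
    intro n
    apply ext_inner_orthonormalBasis_coords bs
    intro i
    rw [hY, inner_ofCoords, inner_sub_right, inner_smul_right, hX, inner_ofCoords, hcoef i n]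
    have hHX : ⟪bs i, H (bs.repr.symm (WithLp.toLp 2 fun j => fourierCoeffOn hab (φ j) n))⟫_ℂ =
        ∑ j, ⟪bs i, H (bs j)⟫_ℂ * fourierCoeffOn hab (φ j) n := by
      conv_lhs => rw [← bs.sum_repr' (bs.repr.symm (WithLp.toLp 2 fun j => fourierCoeffOn hab (φ j) n))]
      simp only [map_sum, map_smul, inner_sum, inner_smul_right, inner_ofCoords]
      exact Finset.sum_congr rfl fun j _ => mul_comm _ _
    rw [hHX]
    have hba : (b : ℂ) - a ≠ 0 := by
      rw [← Complex.ofReal_sub]; exact_mod_cast (sub_pos.mpr hab).ne'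
    push_cast
    ring
  -- Step 4: `Ψ‖Xₙ‖ ≤ ‖Yₙ‖`
  have hXYle : ∀ n : ℤ, Ψ ^ 2 * ‖X n‖ ^ 2 ≤ ‖Y n‖ ^ 2 := by
    intro n
    have h := hΨ (-(2 * π * n / (b - a))) (X n)
    rw [← hXY n] at h
    calc Ψ ^ 2 * ‖X n‖ ^ 2 = (Ψ * ‖X n‖) ^ 2 := by ring
      _ ≤ ‖Y n‖ ^ 2 := pow_le_pow_left₀ (mul_nonneg hΨ0 (norm_nonneg _)) h 2
  -- Step 5–6: Parseval, componentwise, summed over the basis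
  have hmem : ∀ {θ : ℝ → ℂ}, ContinuousOn θ (Icc a b) → MemLp θ 2 (volume.restrict (Ioc a b)) := by
    intro θ hθ
    obtain ⟨C, hC⟩ := (isCompact_Icc (a := a) (b := b)).exists_bound_of_continuousOn hθ
    refine MemLp.of_bound ((hθ.mono Ioc_subset_Icc_self).aestronglyMeasurable measurableSet_Ioc) C ?_
    exact (ae_restrict_mem measurableSet_Ioc).mono fun x hx => hC x (Ioc_subset_Icc_self hx)
  have hii : ∀ {θ : ℝ → ℝ}, ContinuousOn θ (Icc a b) → IntervalIntegrable θ volume a b :=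
    fun hθ => (hθ.mono (by rw [uIcc_of_le hab.le])).intervalIntegrable
  have hpars : ∀ {K : ℝ → E} {κ : Fin (Module.finrank ℂ E) → ℝ → ℂ}, ContinuousOn K (Icc a b) →
      (∀ i x, κ i x = ⟪bs i, K x⟫_ℂ) → (∀ i, ContinuousOn (κ i) (Icc a b)) →
      HasSum (fun n : ℤ => ‖bs.repr.symm (WithLp.toLp 2 fun j => fourierCoeffOn hab (κ j) n)‖ ^ 2)
        ((b - a)⁻¹ • ∫ x in a..b, ‖K x‖ ^ 2) := by
    intro K κ hK hκ hκc
    have h : HasSum (fun n : ℤ => ∑ j, ‖fourierCoeffOn hab (κ j) n‖ ^ 2)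
        (∑ j, (b - a)⁻¹ • ∫ x in a..b, ‖κ j x‖ ^ 2) :=
      hasSum_sum fun j _ => hasSum_sq_fourierCoeffOn hab (hmem (hκc j))
    have h2 : (∑ j, (b - a)⁻¹ • ∫ x in a..b, ‖κ j x‖ ^ 2) = (b - a)⁻¹ • ∫ x in a..b, ‖K x‖ ^ 2 := by
      rw [← Finset.smul_sum, ← intervalIntegral.integral_finsetSum]
      · congr 1
        refine intervalIntegral.integral_congr fun x _ => ?_
        simp only [hκ]
        exact (norm_sq_eq_sum_norm_sq_inner bs (K x)).symm
      · intro j _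
        exact hii ((hκc j).norm.pow 2)
    rw [← h2]
    convert h using 1
    funext n
    exact norm_sq_ofCoords bs _
  have hparsX : HasSum (fun n : ℤ => ‖X n‖ ^ 2) ((b - a)⁻¹ • ∫ x in a..b, ‖F x‖ ^ 2) :=
    hpars hF (fun i x => rfl) hφc
  have hparsY : HasSum (fun n : ℤ => ‖Y n‖ ^ 2) ((b - a)⁻¹ • ∫ x in a..b, ‖G x‖ ^ 2) :=
    hpars hGc (fun i x => rfl) hψc
  -- Step 7: compare the two Parseval sums
  have hle : Ψ ^ 2 * ((b - a)⁻¹ • ∫ x in a..b, ‖F x‖ ^ 2) ≤ (b - a)⁻¹ • ∫ x in a..b, ‖G x‖ ^ 2 :=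
    hasSum_le hXYle (hparsX.mul_left (Ψ ^ 2)) hparsY
  have hba : 0 < b - a := sub_pos.mpr hab
  have h := mul_le_mul_of_nonneg_left hle hba.le
  simp only [smul_eq_mul] at h
  have e1 : (b - a) * (Ψ ^ 2 * ((b - a)⁻¹ * ∫ x in a..b, ‖F x‖ ^ 2)) =
      Ψ ^ 2 * ∫ x in a..b, ‖F x‖ ^ 2 := by field_simp
  have e2 : (b - a) * ((b - a)⁻¹ * ∫ x in a..b, ‖G x‖ ^ 2) = ∫ x in a..b, ‖G x‖ ^ 2 := by field_simp
  rw [e1, e2] at h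
  simpa only [hG] using h

end Vector

end Literature.Analysis.OperatorTheory

end
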